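import Mathlib.NumberTheory.Padics.RingHoms
import Mathlib.NumberTheory.Padics.PadicIntegers
import HarnessLib

/-!
# Route `ByReductionTypeAtTwo`, crux `MultUpperHalfAtTwo` (item stmt-BirchSwinnertonDyer-19922), TOWER road, the
# «ONE BIT AT A NON-SPLIT 2» rows: KERNEL BRICK 2 — the dyadic Hilbert symbol `(2, q)₂ = −1` for
# `q = 2^k u`, `u ≡ ±3 (mod 8)`, in the elementary form «`x² − q y² = 2` has no solution in `ℚ₂`»

HONEST FRAMING (cell `bsd-2adic`, run/shared/lean/pub/bsd-2adic/, seat `bsd-2adic-tower-1` GEN 8, HUMAN RULINGS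
D-0036 / D-0054 / D-0074): TOOL theorems only (no definition, no named fact, no `sorry`); closes nothing by itself;
nothing booked; BSD is not proved by any of this. Second brick of the KERNELISATION of the displayed MEMO binder
`MultTowerNS2.localTowerKerTwoTorsion_le_two_nonsplitTwo_of_tateUnit` (kernel scope HOME/tower/SCOPE-hNS2one-kernel-GEN8.md,
module M2): together with BRICK 1 (`…MultTowerNS2NormTransfer`, the norm principle for `x² − q y²`) it closes step S5
(r = 1) of the scope — «the Tate parameter `q = 2^k u_q`, `u_q ≡ ±3 (mod 8)`, is not a norm from the quadratic layer
`ℚ_{2,n+1} = ℚ_{2,n}(√δ_n)`, `N_{ℚ_{2,n}/ℚ₂} δ_n = 2`» — because that would make `2` a value of `x² − q y²` over `ℚ₂`.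
Stated over Mathlib's `ℚ_[2]` / `ℤ_[2]` (consumers transport along Mathlib's
`Rat.HeightOneSpectrum.adicCompletion.padicEquiv : v.adicCompletion ℚ ≃ₐ[ℚ] ℚ_[2]`). The hypothesis «`u ≡ ±3 (mod 8)`» is
`PadicInt.toZModPow 3 u ∈ {3, 5}`; it is the class of `u` in `ℤ₂ˣ/ℤ₂ˣ²` for which `(2, u)₂ = −1`
(Serre, *Cours d'arithmétique*, III.1.2 Thm. 1: `(2, u)₂ = (−1)^{ω(u)}`, `ω(u) = (u² − 1)/8`); only the elementary
half «`= −1` ⇒ no representation» is proved, by `2`-adic descent: modulo `8` the squares are `{0, 1, 4}`.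

* `sq_sub_mul_sq_ne_two_mul_sq_two_pow` — `x² − u y² ≠ 2·(2^N)²` in `ℤ_[2]` (`u ≡ ±3 (mod 8)`);
* `sq_sub_two_mul_sq_ne_two_mul_sq_two_pow` — `x² − 2u y² ≠ 2·(2^N)²` in `ℤ_[2]`;
* `sq_sub_mul_sq_ne_two_of_tateUnit` — **`x² − (2^k u) y² ≠ 2` for all `x, y ∈ ℚ_[2]`**, every `k : ℕ`.

References: J.-P. Serre, *A Course in Arithmetic*, Ch. III §1.2 Thm. 1 (the dyadic Hilbert symbol); cell memo
PROOF-NS2ONE.md §4 (5) and §7 V2; scope memo SCOPE-hNS2one-kernel-GEN8.md S5/M2.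
-/

set_option autoImplicit false
-- the Theorems namespace of this sub repeats the summit name by design (D-0017 nested layout: Summit.<S>.<Sub>)
set_option linter.dupNamespace false

noncomputable section

namespace Summit.BirchSwinnertonDyer.BirchSwinnertonDyer.Theorems.MultTowerNS2

open PadicInt

/-! ### Arithmetic modulo `8` in `ℤ_[2]` -/

/-- Squares modulo `8` are `0`, `1` or `4` (in `ℤ₂`, via `ℤ₂ → ℤ/8`). [folklore] -/
theorem toZModPow_three_sq (z : ℤ_[2]) :
    toZModPow 3 z ^ 2 = 0 ∨ toZModPow 3 z ^ 2 = 1 ∨ toZModPow 3 z ^ 2 = 4 := by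
  generalize toZModPow 3 z = t
  revert t
  decide

/-- An element of `ℤ₂` whose class modulo `8` is even is divisible by `2`. [folklore] -/
theorem exists_eq_two_mul_of_toZModPow_three {z : ℤ_[2]} {m : ZMod (2 ^ 3)}
    (h : toZModPow 3 z = 2 * m) : ∃ z₁ : ℤ_[2], z = 2 * z₁ := by
  have hker : z - 2 * (m.val : ℤ_[2]) ∈ RingHom.ker (toZModPow (p := 2) 3) := by
    rw [RingHom.mem_ker, map_sub, map_mul, map_natCast, ZMod.natCast_zmod_val, map_ofNat, h, sub_self]
  rw [ker_toZModPow, Ideal.mem_span_singleton] at hker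
  obtain ⟨w, hw⟩ := hker
  push_cast at hw
  exact ⟨(m.val : ℤ_[2]) + 4 * w, by linear_combination hw⟩

/-- If `z² ≡ 0` or `4 (mod 8)` then `2 ∣ z` in `ℤ₂` (an odd `z` has `z² ≡ 1 (mod 8)`). [folklore] -/
theorem exists_eq_two_mul_of_sq {z : ℤ_[2]}
    (h : toZModPow 3 z ^ 2 = 0 ∨ toZModPow 3 z ^ 2 = 4) : ∃ z₁ : ℤ_[2], z = 2 * z₁ := by
  have key : ∀ t : ZMod (2 ^ 3), (t ^ 2 = 0 ∨ t ^ 2 = 4) → ∃ m : ZMod (2 ^ 3), t = 2 * m := by decide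
  obtain ⟨m, hm⟩ := key _ h
  exact exists_eq_two_mul_of_toZModPow_three hm

/-! ### The two descents in `ℤ_[2]` -/

/-- **`x² − u y² ≠ 2·(2^N)²` in `ℤ₂` for `u ≡ ±3 (mod 8)`.** Descent on `N`: for `N = 0` the residues
`x² − u y² (mod 8)` avoid `2`; for `N ≥ 1`, `x² ≡ u y² (mod 8)` forces `y` and then `x` even, and dividing by `4`
lands in case `N − 1`. [folklore] -/
theorem sq_sub_mul_sq_ne_two_mul_sq_two_pow {u : ℤ_[2]} (hu : toZModPow 3 u = 3 ∨ toZModPow 3 u = 5) (N : ℕ)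
    (x y : ℤ_[2]) : x ^ 2 - u * y ^ 2 ≠ 2 * (2 ^ N) ^ 2 := by
  induction N generalizing x y with
  | zero =>
    intro h
    have h8 := congrArg (toZModPow (p := 2) 3) h
    simp only [map_sub, map_mul, map_pow, map_ofNat, pow_zero, one_pow, mul_one] at h8
    have hx := toZModPow_three_sq x
    have hy := toZModPow_three_sq y
    revert h8
    rcases hu with hu | hu <;> rw [hu] <;> rcases hx with hx | hx | hx <;> rw [hx] <;>
      rcases hy with hy | hy | hy <;> rw [hy] <;> decide
  | succ N ih =>
    intro h
    have h8 := congrArg (toZModPow (p := 2) 3) h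
    simp only [map_sub, map_mul, map_pow, map_ofNat] at h8
    rw [show (2 : ZMod (2 ^ 3)) ^ (N + 1) = 2 ^ N * 2 from pow_succ 2 N] at h8
    have h80 : toZModPow 3 x ^ 2 - toZModPow 3 u * toZModPow 3 y ^ 2 = 0 := by
      rw [h8]
      generalize (2 : ZMod (2 ^ 3)) ^ N = s
      revert s; decide
    have hx := toZModPow_three_sq x
    have hy := toZModPow_three_sq y
    -- `y` is even: otherwise `x² ≡ u (mod 8)`, not a square
    have hy' : toZModPow 3 y ^ 2 = 0 ∨ toZModPow 3 y ^ 2 = 4 := by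
      rcases hy with hy | hy | hy
      · exact Or.inl hy
      · exfalso
        revert h80
        rw [hy]
        rcases hu with hu | hu <;> rw [hu] <;> rcases hx with hx | hx | hx <;> rw [hx] <;> decide
      · exact Or.inr hy
    -- `x` is even: `x² ≡ u y² ∈ {0, 4} (mod 8)`
    have hx' : toZModPow 3 x ^ 2 = 0 ∨ toZModPow 3 x ^ 2 = 4 := by
      rcases hx with hx | hx | hx
      · exact Or.inl hx
      · exfalso
        revert h80
        rw [hx]
        rcases hu with hu | hu <;> rw [hu] <;> rcases hy' with hy | hy <;> rw [hy] <;> decide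
      · exact Or.inr hx
    obtain ⟨x₁, rfl⟩ := exists_eq_two_mul_of_sq hx'
    obtain ⟨y₁, rfl⟩ := exists_eq_two_mul_of_sq hy'
    refine ih x₁ y₁ ?_
    have h4 : (4 : ℤ_[2]) * (x₁ ^ 2 - u * y₁ ^ 2) = 4 * (2 * (2 ^ N) ^ 2) := by linear_combination h
    exact mul_left_cancel₀ (by norm_num) h4

/-- **`x² − 2u y² ≠ 2·(2^N)²` in `ℤ₂` for `u ≡ ±3 (mod 8)`.** `x` is even, `x = 2x₁`, `2x₁² = u y² + 4^N`; for
`N = 0`, `y` is odd and `2x₁² ≡ u + 1 ∈ {4, 6} (mod 8)` is impossible (`2x₁² ∈ {0, 2}`); for `N ≥ 1`, `y` is even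
and dividing by `4` lands in case `N − 1`. [folklore] -/
theorem sq_sub_two_mul_sq_ne_two_mul_sq_two_pow {u : ℤ_[2]} (hu : toZModPow 3 u = 3 ∨ toZModPow 3 u = 5)
    (N : ℕ) (x y : ℤ_[2]) : x ^ 2 - 2 * u * y ^ 2 ≠ 2 * (2 ^ N) ^ 2 := by
  induction N generalizing x y with
  | zero =>
    intro h
    have hx := toZModPow_three_sq x
    have hy := toZModPow_three_sq y
    -- `x` is even
    have h8 := congrArg (toZModPow (p := 2) 3) h
    simp only [map_sub, map_mul, map_pow, map_ofNat, pow_zero, one_pow, mul_one] at h8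
    have hx' : toZModPow 3 x ^ 2 = 0 ∨ toZModPow 3 x ^ 2 = 4 := by
      rcases hx with hx | hx | hx
      · exact Or.inl hx
      · exfalso; revert h8; rw [hx]
        rcases hu with hu | hu <;> rw [hu] <;> rcases hy with hy | hy | hy <;> rw [hy] <;> decide
      · exact Or.inr hx
    obtain ⟨x₁, rfl⟩ := exists_eq_two_mul_of_sq hx'
    -- `2 x₁² = u y² + 1`
    have h2 : 2 * x₁ ^ 2 - u * y ^ 2 = 1 := by
      have : (2 : ℤ_[2]) * (2 * x₁ ^ 2 - u * y ^ 2) = 2 * 1 := by linear_combination h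
      exact mul_left_cancel₀ (by norm_num) this
    have h28 := congrArg (toZModPow (p := 2) 3) h2
    simp only [map_sub, map_mul, map_pow, map_ofNat, map_one] at h28
    have hx₁ := toZModPow_three_sq x₁
    revert h28
    rcases hu with hu | hu <;> rw [hu] <;> rcases hx₁ with h1 | h1 | h1 <;> rw [h1] <;>
      rcases hy with hy | hy | hy <;> rw [hy] <;> decide
  | succ N ih =>
    intro h
    have hx := toZModPow_three_sq x
    have hy := toZModPow_three_sq y
    have h8 := congrArg (toZModPow (p := 2) 3) h
    simp only [map_sub, map_mul, map_pow, map_ofNat] at h8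
    rw [show (2 : ZMod (2 ^ 3)) ^ (N + 1) = 2 ^ N * 2 from pow_succ 2 N] at h8
    have h80 : toZModPow 3 x ^ 2 - 2 * toZModPow 3 u * toZModPow 3 y ^ 2 = 0 := by
      rw [h8]
      generalize (2 : ZMod (2 ^ 3)) ^ N = s
      revert s; decide
    -- `x` even
    have hx' : toZModPow 3 x ^ 2 = 0 ∨ toZModPow 3 x ^ 2 = 4 := by
      rcases hx with hx | hx | hx
      · exact Or.inl hx
      · exfalso; revert h80; rw [hx]
        rcases hu with hu | hu <;> rw [hu] <;> rcases hy with hy | hy | hy <;> rw [hy] <;> decide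
      · exact Or.inr hx
    obtain ⟨x₁, rfl⟩ := exists_eq_two_mul_of_sq hx'
    -- `2 x₁² = u y² + 4^{N+1}`, so `y` is even
    have h2 : 2 * x₁ ^ 2 - u * y ^ 2 = (2 ^ (N + 1)) ^ 2 := by
      have : (2 : ℤ_[2]) * (2 * x₁ ^ 2 - u * y ^ 2) = 2 * (2 ^ (N + 1)) ^ 2 := by linear_combination h
      exact mul_left_cancel₀ (by norm_num) this
    have h28 := congrArg (toZModPow (p := 2) 3) h2
    simp only [map_sub, map_mul, map_pow, map_ofNat] at h28
    rw [show (2 : ZMod (2 ^ 3)) ^ (N + 1) = 2 ^ N * 2 from pow_succ 2 N] at h28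
    have h280 : 2 * toZModPow 3 x₁ ^ 2 - toZModPow 3 u * toZModPow 3 y ^ 2 = 0 ∨
        2 * toZModPow 3 x₁ ^ 2 - toZModPow 3 u * toZModPow 3 y ^ 2 = 4 := by
      rw [h28]
      generalize (2 : ZMod (2 ^ 3)) ^ N = s
      revert s; decide
    have hx₁ := toZModPow_three_sq x₁
    have hy' : toZModPow 3 y ^ 2 = 0 ∨ toZModPow 3 y ^ 2 = 4 := by
      rcases hy with hy | hy | hy
      · exact Or.inl hy
      · exfalso; revert h280; rw [hy]
        rcases hu with hu | hu <;> rw [hu] <;> rcases hx₁ with h1 | h1 | h1 <;> rw [h1] <;> decide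
      · exact Or.inr hy
    obtain ⟨y₁, rfl⟩ := exists_eq_two_mul_of_sq hy'
    refine ih x₁ y₁ ?_
    have h4 : (4 : ℤ_[2]) * (x₁ ^ 2 - 2 * u * y₁ ^ 2) = 4 * (2 * (2 ^ N) ^ 2) := by linear_combination h
    exact mul_left_cancel₀ (by norm_num) h4

/-! ### Clearing denominators: the statement over `ℚ_[2]` -/

/-- Any element of `ℚ₂` becomes `2`-integral after multiplication by a power of `2`. [folklore] -/
theorem exists_norm_two_pow_mul_le_one (x : ℚ_[2]) : ∃ N : ℕ, ‖(2 : ℚ_[2]) ^ N * x‖ ≤ 1 := by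
  obtain ⟨N, hN⟩ := pow_unbounded_of_one_lt ‖x‖ (by norm_num : (1 : ℝ) < 2)
  refine ⟨N, ?_⟩
  rw [norm_mul, show ((2 : ℚ_[2]) = ((2 : ℕ) : ℚ_[2])) by norm_cast, Padic.norm_p_pow]
  have h2 : (0 : ℝ) < (2 : ℝ) ^ N := by positivity
  rw [show ((2 : ℕ) : ℝ) ^ (-(N : ℤ)) = ((2 : ℝ) ^ N)⁻¹ by rw [zpow_neg, zpow_natCast]; norm_cast,
    inv_mul_le_iff₀ h2, mul_one]
  exact hN.le

/-- `‖2‖₂ ≤ 1`, hence `‖2^N‖₂ ≤ 1`. [folklore] -/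
theorem norm_two_pow_le_one (N : ℕ) : ‖(2 : ℚ_[2]) ^ N‖ ≤ 1 := by
  rw [norm_pow]
  refine pow_le_one₀ (norm_nonneg _) ?_
  rw [show ((2 : ℚ_[2]) = ((2 : ℕ) : ℚ_[2])) by norm_cast, Padic.norm_p]
  norm_num

/-- **`x² − (2^k u) y² ≠ 2` in `ℚ₂` for `u ∈ ℤ₂`, `u ≡ ±3 (mod 8)`, every `k`** — the dyadic Hilbert symbol
`(2, 2^k u)₂ = −1` in the form the «one bit at a non-split 2» kernel proof consumes (`q = 2^k u_q` the Tate parameter).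
Clearing denominators by `2^N` turns a solution into `x₀² − 2^e u y₀² = 2·(2^N)²` in `ℤ₂` with `e = k mod 2`
(absorbing `2^{⌊k/2⌋}` into `y₀`), excluded by the two descents. [folklore] -/
theorem sq_sub_mul_sq_ne_two_of_tateUnit {u : ℤ_[2]} (hu : toZModPow 3 u = 3 ∨ toZModPow 3 u = 5) (k : ℕ)
    (x y : ℚ_[2]) : x ^ 2 - ((2 : ℚ_[2]) ^ k * u) * y ^ 2 ≠ 2 := by
  intro h
  obtain ⟨N₁, hN₁⟩ := exists_norm_two_pow_mul_le_one x
  obtain ⟨N₂, hN₂⟩ := exists_norm_two_pow_mul_le_one y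
  -- a common exponent
  have hx : ‖(2 : ℚ_[2]) ^ (N₁ + N₂) * x‖ ≤ 1 := by
    rw [pow_add, mul_comm ((2 : ℚ_[2]) ^ N₁), mul_assoc, norm_mul]
    exact mul_le_one₀ (norm_two_pow_le_one N₂) (norm_nonneg _) hN₁
  have hy : ‖(2 : ℚ_[2]) ^ (N₁ + N₂) * y‖ ≤ 1 := by
    rw [pow_add, mul_assoc, norm_mul]
    exact mul_le_one₀ (norm_two_pow_le_one N₁) (norm_nonneg _) hN₂
  set N := N₁ + N₂ with hN
  let x₀ : ℤ_[2] := ⟨(2 : ℚ_[2]) ^ N * x, hx⟩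
  let y₀ : ℤ_[2] := ⟨(2 : ℚ_[2]) ^ N * y, hy⟩
  have cx : (x₀ : ℚ_[2]) = (2 : ℚ_[2]) ^ N * x := rfl
  have cy : (y₀ : ℚ_[2]) = (2 : ℚ_[2]) ^ N * y := rfl
  have c2 : ((2 : ℤ_[2]) : ℚ_[2]) = 2 := by norm_cast
  -- the integral equation `x₀² − 2^k u y₀² = 2 · (2^N)²`
  have hint : x₀ ^ 2 - (2 : ℤ_[2]) ^ k * u * y₀ ^ 2 = 2 * ((2 : ℤ_[2]) ^ N) ^ 2 := by
    apply Subtype.ext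
    push_cast
    rw [cx, cy, c2]
    linear_combination ((2 : ℚ_[2]) ^ N) ^ 2 * h
  -- absorb `2^{k/2}` into `y₀` and split on the parity of `k`
  obtain ⟨j, hj | hj⟩ := Nat.even_or_odd' k
  · refine sq_sub_mul_sq_ne_two_mul_sq_two_pow hu N x₀ (2 ^ j * y₀) ?_
    rw [← hint, hj]; ring
  · refine sq_sub_two_mul_sq_ne_two_mul_sq_two_pow hu N x₀ (2 ^ j * y₀) ?_
    rw [← hint, hj]; ring

end Summit.BirchSwinnertonDyer.BirchSwinnertonDyer.Theorems.MultTowerNS2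

end
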